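import Mathlib

/-!
# T5PadicOpenSubgroups — the open additive subgroups of `ℤ_p` are exactly the `p^k ℤ_p`

Cell pub-hodge-repro2, Tier 5 support (seat p7; route/T5-CHECK-G-p7.md §3 S5 / S8, route/T5-LEAN-p7.md).
§G's chain S5 / S8 works on the group `Γ_𝔭 ≅ ℤ_p` («finite order, p-power order since Γ_𝔭 ≅ ℤ_p»,
«ν ∈ Ξ_𝔭 with ν(γ₀) = ζ ∈ μ_{p^∞}»). The elementary input behind both sentences is the structure of
the open subgroups of `ℤ_p`, recorded here in Mathlib's `ℤ_[p]`:

* `isClopen_span_pow`: `p^k ℤ_p = {x : ‖x‖ ≤ p^{-k}}` is clopen;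
* `exists_span_pow_le_of_isOpen`: an open additive subgroup contains some `p^k ℤ_p`;
* `mul_mem_of_isOpen` / `exists_ideal_toAddSubgroup_eq`: an open additive subgroup is an IDEAL
  (an integer approximation `r ≡ appr r k (mod p^k)` splits `r x` into `(integer) • x + p^k(…)`);
* `eq_span_pow_of_isOpen`: hence it is `p^k ℤ_p` for some `k` (Mathlib's `PadicInt.ideal_eq_span_pow_p`);
* `index_span_pow`: `[ℤ_p : p^k ℤ_p] = p^k` (via `ℤ_p / p^k ℤ_p ≃ ZMod (p^k)`, `PadicInt.toZModPow`);
* `exists_unique_index_eq_pow_of_isOpen`: the open additive subgroups of `ℤ_p` are exactly the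
  `p^k ℤ_p`, `k` determined by the index `p^k`.

Nothing about characters, measures or L-functions is asserted; Mathlib only.
-/

namespace Summit.Ventures.HodgeRepro2.T5PadicOpenSubgroups

open PadicInt Filter Topology Metric

variable {p : ℕ} [hp : Fact p.Prime]

/-- `p^k ℤ_p` is the closed ball of radius `p^{-k}` about `0` (Mathlib's `norm_le_pow_iff_mem_span_pow`). -/
theorem coe_span_pow_eq_closedBall (k : ℕ) :
    ((Ideal.span {(p : ℤ_[p]) ^ k} : Ideal ℤ_[p]) : Set ℤ_[p]) =
      closedBall (0 : ℤ_[p]) ((p : ℝ) ^ (-(k : ℤ))) := by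
  ext x
  simp only [SetLike.mem_coe, mem_closedBall, dist_zero_right]
  exact (norm_le_pow_iff_mem_span_pow x k).symm

/-- `p^k ℤ_p` is open in `ℤ_p` (a closed ball of positive radius in an ultrametric space is open). -/
theorem isOpen_span_pow (k : ℕ) :
    IsOpen ((Ideal.span {(p : ℤ_[p]) ^ k} : Ideal ℤ_[p]) : Set ℤ_[p]) := by
  rw [coe_span_pow_eq_closedBall]
  refine IsUltrametricDist.isOpen_closedBall _ ?_
  have : (0 : ℝ) < (p : ℝ) ^ (-(k : ℤ)) := by
    have := hp.out.pos
    positivity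
  exact this.ne'

/-- `p^k ℤ_p` is closed in `ℤ_p`. -/
theorem isClosed_span_pow (k : ℕ) :
    IsClosed ((Ideal.span {(p : ℤ_[p]) ^ k} : Ideal ℤ_[p]) : Set ℤ_[p]) := by
  rw [coe_span_pow_eq_closedBall]
  exact isClosed_closedBall

/-- `p^k ℤ_p` is clopen in `ℤ_p`. -/
theorem isClopen_span_pow (k : ℕ) :
    IsClopen ((Ideal.span {(p : ℤ_[p]) ^ k} : Ideal ℤ_[p]) : Set ℤ_[p]) :=
  ⟨isClosed_span_pow k, isOpen_span_pow k⟩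

/-- An open additive subgroup of `ℤ_p` contains `p^k ℤ_p` for some `k`
(it contains a ball about `0`, and the balls `p^k ℤ_p` are a basis). -/
theorem exists_span_pow_le_of_isOpen (H : AddSubgroup ℤ_[p]) (hH : IsOpen (H : Set ℤ_[p])) :
    ∃ k : ℕ, (Ideal.span {(p : ℤ_[p]) ^ k}).toAddSubgroup ≤ H := by
  obtain ⟨ε, hε, hball⟩ := Metric.isOpen_iff.mp hH 0 H.zero_mem
  obtain ⟨k, hk⟩ := exists_pow_neg_lt p hε
  refine ⟨k, fun x hx => hball ?_⟩
  rw [mem_ball, dist_zero_right]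
  exact lt_of_le_of_lt ((norm_le_pow_iff_mem_span_pow x k).mpr hx) hk

/-- An open additive subgroup of `ℤ_p` is stable under multiplication by every `r ∈ ℤ_p`:
write `r = appr r k + (r - appr r k)` with `appr r k ∈ ℕ` and `r - appr r k ∈ p^k ℤ_p ⊆ H`
(Mathlib's `PadicInt.appr_spec`), so `r x = appr r k • x + (r - appr r k) x ∈ H`. -/
theorem mul_mem_of_isOpen (H : AddSubgroup ℤ_[p]) (hH : IsOpen (H : Set ℤ_[p]))
    (r : ℤ_[p]) {x : ℤ_[p]} (hx : x ∈ H) : r * x ∈ H := by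
  obtain ⟨k, hk⟩ := exists_span_pow_le_of_isOpen H hH
  have h1 : (r - (appr r k : ℤ_[p])) * x ∈ H := by
    apply hk
    rw [Submodule.mem_toAddSubgroup]
    exact Ideal.mul_mem_right _ _ (appr_spec k r)
  have h2 : ((appr r k : ℕ) : ℤ_[p]) * x ∈ H := by
    rw [← nsmul_eq_mul]
    exact H.nsmul_mem hx _
  have : r * x = (r - (appr r k : ℤ_[p])) * x + ((appr r k : ℕ) : ℤ_[p]) * x := by ring
  rw [this]
  exact H.add_mem h1 h2

/-- An open additive subgroup of `ℤ_p` is (the additive group of) an ideal. -/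
theorem exists_ideal_toAddSubgroup_eq (H : AddSubgroup ℤ_[p]) (hH : IsOpen (H : Set ℤ_[p])) :
    ∃ I : Ideal ℤ_[p], I.toAddSubgroup = H := by
  refine ⟨{ carrier := H
            add_mem' := fun ha hb => H.add_mem ha hb
            zero_mem' := H.zero_mem
            smul_mem' := fun r x hx => by
              rw [smul_eq_mul]
              exact mul_mem_of_isOpen H hH r hx }, ?_⟩
  ext x
  rfl

/-- `p ≠ 0` in `ℤ_p`. -/
theorem natCast_prime_ne_zero : (p : ℤ_[p]) ≠ 0 := by
  intro h
  have := norm_p (p := p)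
  rw [h, norm_zero] at this
  have hp0 : (0 : ℝ) < (p : ℝ)⁻¹ := by
    have := hp.out.pos
    positivity
  linarith

/-- THE CLASSIFICATION: every open additive subgroup of `ℤ_p` is `p^k ℤ_p` for some `k`
(an ideal containing `p^j ≠ 0`, hence non-zero, hence `p^k ℤ_p` by Mathlib's `ideal_eq_span_pow_p`). -/
theorem eq_span_pow_of_isOpen (H : AddSubgroup ℤ_[p]) (hH : IsOpen (H : Set ℤ_[p])) :
    ∃ k : ℕ, H = (Ideal.span {(p : ℤ_[p]) ^ k}).toAddSubgroup := by
  obtain ⟨I, rfl⟩ := exists_ideal_toAddSubgroup_eq H hH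
  obtain ⟨j, hj⟩ := exists_span_pow_le_of_isOpen _ hH
  have hI : I ≠ ⊥ := by
    intro hbot
    have hmem : (p : ℤ_[p]) ^ j ∈ I := by
      have : (p : ℤ_[p]) ^ j ∈ (Ideal.span {(p : ℤ_[p]) ^ j}).toAddSubgroup := by
        rw [Submodule.mem_toAddSubgroup]
        exact Ideal.mem_span_singleton_self _
      simpa [Submodule.mem_toAddSubgroup] using hj this
    rw [hbot, Ideal.mem_bot] at hmem
    exact pow_ne_zero j natCast_prime_ne_zero hmem
  obtain ⟨k, hk⟩ := ideal_eq_span_pow_p hI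
  exact ⟨k, by rw [hk]⟩

/-- `toZModPow k : ℤ_p → ℤ/p^kℤ` is surjective (`n ↦ n` on natural numbers). -/
theorem toZModPow_surjective (k : ℕ) : Function.Surjective (toZModPow k : ℤ_[p] → ZMod (p ^ k)) := by
  intro y
  refine ⟨(y.val : ℤ_[p]), ?_⟩
  rw [map_natCast, ZMod.natCast_zmod_val]

/-- The additive kernel of `toZModPow k` is `p^k ℤ_p` (Mathlib's `ker_toZModPow`, additive form). -/
theorem ker_toZModPow_toAddMonoidHom (k : ℕ) :
    AddMonoidHom.ker (toZModPow k : ℤ_[p] →+* ZMod (p ^ k)).toAddMonoidHom =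
      (Ideal.span {(p : ℤ_[p]) ^ k}).toAddSubgroup := by
  ext x
  rw [AddMonoidHom.mem_ker, Submodule.mem_toAddSubgroup, ← ker_toZModPow, RingHom.mem_ker]
  rfl

/-- `ℤ_p / p^k ℤ_p ≃+ ℤ/p^kℤ` (the additive form of Mathlib's `toZModPow`). -/
noncomputable def quotientSpanPowEquivZMod (k : ℕ) :
    ℤ_[p] ⧸ (Ideal.span {(p : ℤ_[p]) ^ k}).toAddSubgroup ≃+ ZMod (p ^ k) :=
  (QuotientAddGroup.quotientAddEquivOfEq (ker_toZModPow_toAddMonoidHom k).symm).trans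
    (QuotientAddGroup.quotientKerEquivOfSurjective
      (toZModPow k : ℤ_[p] →+* ZMod (p ^ k)).toAddMonoidHom (toZModPow_surjective k))

/-- `[ℤ_p : p^k ℤ_p] = p^k`. -/
theorem index_span_pow (k : ℕ) :
    (Ideal.span {(p : ℤ_[p]) ^ k}).toAddSubgroup.index = p ^ k := by
  rw [AddSubgroup.index_eq_card, Nat.card_congr (quotientSpanPowEquivZMod k).toEquiv, Nat.card_zmod]

/-- An open additive subgroup of `ℤ_p` has index a power of `p` — in particular finite index. -/
theorem exists_index_eq_pow_of_isOpen (H : AddSubgroup ℤ_[p]) (hH : IsOpen (H : Set ℤ_[p])) :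
    ∃ k : ℕ, H.index = p ^ k := by
  obtain ⟨k, rfl⟩ := eq_span_pow_of_isOpen H hH
  exact ⟨k, index_span_pow k⟩

/-- An open additive subgroup of `ℤ_p` has finite index. -/
theorem finiteIndex_of_isOpen (H : AddSubgroup ℤ_[p]) (hH : IsOpen (H : Set ℤ_[p])) :
    H.FiniteIndex := by
  obtain ⟨k, hk⟩ := exists_index_eq_pow_of_isOpen H hH
  exact ⟨by rw [hk]; exact pow_ne_zero _ hp.out.ne_zero⟩

/-- The exponent `k` with `H = p^k ℤ_p` is determined by `H`: `p^k = [ℤ_p : H]`. -/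
theorem eq_of_span_pow_eq {k l : ℕ}
    (h : (Ideal.span {(p : ℤ_[p]) ^ k}).toAddSubgroup = (Ideal.span {(p : ℤ_[p]) ^ l}).toAddSubgroup) :
    k = l := by
  have := congrArg AddSubgroup.index h
  rw [index_span_pow, index_span_pow] at this
  exact Nat.pow_right_injective hp.out.two_le this

/-- THE OPEN ADDITIVE SUBGROUPS OF `ℤ_p` ARE EXACTLY THE `p^k ℤ_p`: existence and uniqueness of `k`,
with `[ℤ_p : H] = p^k`. -/
theorem existsUnique_eq_span_pow_of_isOpen (H : AddSubgroup ℤ_[p]) (hH : IsOpen (H : Set ℤ_[p])) :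
    ∃! k : ℕ, H = (Ideal.span {(p : ℤ_[p]) ^ k}).toAddSubgroup ∧ H.index = p ^ k := by
  obtain ⟨k, rfl⟩ := eq_span_pow_of_isOpen H hH
  refine ⟨k, ⟨rfl, index_span_pow k⟩, fun l hl => (eq_of_span_pow_eq hl.1).symm⟩

/-- Conversely every `p^k ℤ_p` is an open additive subgroup: the open additive subgroups of `ℤ_p`
are exactly the `p^k ℤ_p`. -/
theorem isOpen_iff_exists_eq_span_pow (H : AddSubgroup ℤ_[p]) :
    IsOpen (H : Set ℤ_[p]) ↔ ∃ k : ℕ, H = (Ideal.span {(p : ℤ_[p]) ^ k}).toAddSubgroup := by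
  refine ⟨eq_span_pow_of_isOpen H, ?_⟩
  rintro ⟨k, rfl⟩
  exact isOpen_span_pow k

/-- An open additive subgroup of `ℤ_p` is closed (it is some `p^k ℤ_p`). -/
theorem isClosed_of_isOpen (H : AddSubgroup ℤ_[p]) (hH : IsOpen (H : Set ℤ_[p])) :
    IsClosed (H : Set ℤ_[p]) := by
  obtain ⟨k, rfl⟩ := eq_span_pow_of_isOpen H hH
  exact isClosed_span_pow k

/-- The multiples `p^k • x` (`x ∈ ℤ_p`) lie in every open additive subgroup `H` for `k` large:
the quantitative form used for characters («`κ (p^k x) = 1` for all `x`»). -/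
theorem exists_forall_pow_mul_mem_of_isOpen (H : AddSubgroup ℤ_[p]) (hH : IsOpen (H : Set ℤ_[p])) :
    ∃ k : ℕ, ∀ x : ℤ_[p], (p : ℤ_[p]) ^ k * x ∈ H := by
  obtain ⟨k, hk⟩ := exists_span_pow_le_of_isOpen H hH
  refine ⟨k, fun x => hk ?_⟩
  rw [Submodule.mem_toAddSubgroup]
  exact Ideal.mul_mem_right _ _ (Ideal.mem_span_singleton_self _)

end Summit.Ventures.HodgeRepro2.T5PadicOpenSubgroups
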